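import Mathlib

/-!
# Hodge-locus census (cell `pub-hlocus`, engine B, abs-2 gen 49)

The combinatorial core of the local Galois-orbit laws ORB1 / ORB4 for the pair
polynomials `R_{D,D'}(x) = Res_y(H_D(y), H_{D'}(x+y))` at the prime 3 (census record
`code/abs_engineB/v3B/xt/ta8B/DERIVATION-ORB-B.md`, registered 2026-08-23T10:28:03Z
before any production output).

certified instances and evidence bearing on the general Hodge conjecture; no claim.

Helper file of `stmt-HodgeConjecture-16267` (computational census records; nothing here
is used by any route).  The group `G = Gal(ℚ₃(ζ₁₂)/ℚ₃) ≅ C₂ × C₂` permutes the index set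
`Cl(D) × Cl(D')` of the roots `x_{𝔞𝔟} = j'_𝔟 − j_𝔞` componentwise (DERIVATION-ORB-B §1).
The three elementary facts the laws rest on are kernel-checked here in the generality
in which they are used:
* `two_dvd_card_of_fixedPointFree_involution` (ORB1, multiplicity half): an involution
  of a finite set without fixed points has an even number of points — applied to an
  element of the stabiliser of a root acting on that root's multiplicity set;
* `card_orbit_mem_of_card_group_eq_four` (ORB0/ORB1, degree half): under a group of
  order 4 every orbit has 1, 2 or 4 elements (so every `ℚ₃`-irreducible factor of `R`,
  resp. of `H_D`, has degree 1, 2 or 4);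
* `card_fixedPoints_prodMap` (ORB4, the product law `n₉(D,D') = r₉(D)·r₉(D')`,
  `n_⊥ = r_⊥(D)·r_⊥(D')` for generic pairs): the fixed points of a componentwise map on
  a product are the product of the fixed-point sets, so their number multiplies.
The arithmetic input (which classes `ι`, `φ_⊥`, `φ_K` fix; CM values in `ℚ₃(ζ₁₂)`) is in
the census record; the production evidence is kit `j192199` (W1: 378 pairs, 3192 law
checks, 0 failures), `j192249` (W2: 268 pairs, 2456 law checks, 0 failures) and the W3
shards under `data/abs/engineB/v3/xt/ta8B/`.
-/

set_option linter.dupNamespace false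

namespace Summit.HodgeConjecture.HodgeConjecture.HodgeLocus.Census.PairOrbitAnchorsB

open Equiv Finset

/-- ORB1 (multiplicity half): a fixed-point-free involution of a finite type has an even
number of points. -/
theorem two_dvd_card_of_fixedPointFree_involution {α : Type*} [Fintype α] [DecidableEq α]
    (σ : Perm α) (hσ : σ ^ 2 = 1) (hfree : ∀ x, σ x ≠ x) : 2 ∣ Fintype.card α := by
  have hsupp : σ.support = Finset.univ := by
    ext x
    simp [Perm.mem_support, hfree x]
  have h := Perm.two_dvd_card_support hσ
  rwa [hsupp, Finset.card_univ] at h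

/-- ORB0/ORB1 (degree half): under a group of order 4, every orbit has 1, 2 or 4 elements. -/
theorem card_orbit_mem_of_card_group_eq_four {G α : Type*} [Group G] [Fintype G] [MulAction G α]
    (hG : Fintype.card G = 4) (a : α) [Fintype (MulAction.orbit G a)]
    [Fintype (MulAction.stabilizer G a)] :
    Fintype.card (MulAction.orbit G a) ∈ ({1, 2, 4} : Finset ℕ) := by
  have h := MulAction.card_orbit_mul_card_stabilizer_eq_card_group G a
  rw [hG] at h
  have hdvd : Fintype.card (MulAction.orbit G a) ∣ 4 := Dvd.intro _ h
  have hle : Fintype.card (MulAction.orbit G a) ≤ 4 := Nat.le_of_dvd (by norm_num) hdvd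
  interval_cases (Fintype.card (MulAction.orbit G a)) <;> simp_all

/-- ORB4 (product law): the fixed points of a componentwise map are the product of the
fixed-point sets. -/
theorem filter_fixedPoints_prodMap {α β : Type*} [Fintype α] [Fintype β] [DecidableEq α]
    [DecidableEq β] (f : α → α) (g : β → β) :
    (Finset.univ.filter fun p : α × β => Prod.map f g p = p)
      = (Finset.univ.filter fun a : α => f a = a) ×ˢ (Finset.univ.filter fun b : β => g b = b) := by
  ext ⟨a, b⟩
  simp [Prod.ext_iff]

/-- ORB4 (product law, counted): the number of fixed points multiplies. -/
theorem card_fixedPoints_prodMap {α β : Type*} [Fintype α] [Fintype β] [DecidableEq α]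
    [DecidableEq β] (f : α → α) (g : β → β) :
    (Finset.univ.filter fun p : α × β => Prod.map f g p = p).card
      = (Finset.univ.filter fun a : α => f a = a).card
        * (Finset.univ.filter fun b : β => g b = b).card := by
  rw [filter_fixedPoints_prodMap, Finset.card_product]

/-- ORB1 as used: if an involution `g` of the index set fixes the root `x₀` (i.e. preserves its
multiplicity set `M`) and moves every index in `M`, then the multiplicity `#M` is even.
Stated for a `g`-stable finset. -/
theorem even_card_of_stable_fixedPointFree {ι : Type*} [DecidableEq ι] (g : ι → ι)
    (hg : ∀ i, g (g i) = i) (M : Finset ι) (hM : ∀ i ∈ M, g i ∈ M) (hfree : ∀ i ∈ M, g i ≠ i) :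
    2 ∣ M.card := by
  classical
  -- restrict `g` to an involution of the subtype `M`
  let σ : Perm M :=
    { toFun := fun i => ⟨g i, hM i i.2⟩
      invFun := fun i => ⟨g i, hM i i.2⟩
      left_inv := fun i => Subtype.ext (hg i)
      right_inv := fun i => Subtype.ext (hg i) }
  have hσ : σ ^ 2 = 1 := by
    ext i
    simp [σ, pow_two, Perm.mul_apply, hg]
  have hfree' : ∀ i : M, σ i ≠ i := fun i h =>
    hfree i i.2 (by simpa [σ] using congrArg Subtype.val h)
  have := two_dvd_card_of_fixedPointFree_involution σ hσ hfree'
  simpa using this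

end Summit.HodgeConjecture.HodgeConjecture.HodgeLocus.Census.PairOrbitAnchorsB
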